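import Mathlib
import Summits.Ventures.PercRepro2.Defs
import Summits.Ventures.PercRepro2.Independence
import Summits.Ventures.PercRepro2.Harris
import Summits.Ventures.PercRepro2.Graph
import Summits.Ventures.PercRepro2.Exploration
import Summits.Ventures.PercRepro2.Events
import Summits.Ventures.PercRepro2.FourFunctions
import Summits.Ventures.PercRepro2.Induced
import Summits.Ventures.PercRepro2.Frontier
import Summits.Ventures.PercRepro2.ObsIndependence
import Summits.Ventures.PercRepro2.BHK
import Summits.Ventures.PercRepro2.BHKEvents
import Summits.Ventures.PercRepro2.OrderPreservation

/-!
# Quantitative R10 at one root (blind cell PercRepro2, p1; LEAD-PROOFSHAPES §8.9 ADDENDUM 6)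

For a root `s`, its cluster `C = C(s)`, and vertices `o, y, b`:

  `P(o ∈ C, b ∈ C, y ∉ C) − P(o ∈ C, y ∉ C, y ↔ b) ≥ P(o ∈ C | y ∉ C) · (P(b ∈ C) − P(y ↔ b) − P(y | b))`,

where `P(y | b) = P(y ∈ C, b ∈ C, y ↮ b)` — no order hypothesis. Proof: the BHK same-cluster
inequality conditionally on `{y ∉ C}` (`bhk_same_cluster`) for the monotone functionals
`F₁ = 1{o ∈ W}` and `F₂ = 1{b ∈ W} + 1 − π_y(W)`, `π_y(W) = P_{G∖W}(y ↔ b)` (antitone,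
`delClusterProb`); the tower identity `prob_clusterIn_inter_eq_expect` turns `E[π_y(C); …]` into
`P(y ↔ b, …)`, and the cancellation `P(b ∈ C, y ∉ C) − P(y ↔ b, y ∉ C) = P(b ∈ C) − P(y ↔ b) − P(y | b)`
(`y ↔ b` and `y ∈ C` force `b ∈ C`) gives the stated form. This is the one-root engine of the
R2′(3) ⇐ (SC′) reduction (mine-2's `r2prime3_of_quant_of_SC`, after the merge `a₂ = a₃`).
-/

namespace Summit.Ventures.PercRepro2

section Quant

variable {V : Type*} {E : Type*} [Fintype E] [DecidableEq E] [Fintype V] [DecidableEq V]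
  {R : Type*} [Field R] [LinearOrder R] [IsStrictOrderedRing R]

omit [Fintype V] [DecidableEq V] in
/-- The cancellation: `P(b ∈ C_s, s ↮ y) − P(y ↔ b, s ↮ y) = P(s ↔ b) − P(y ↔ b) − P(y | b)`. -/
lemma prob_conn_sub_eq_split (p : E → R) (ends : E → Sym2 V) (s y b : V) :
    prob p (connEvent ends s b ∩ (connEvent ends s y)ᶜ) -
        prob p (connEvent ends y b ∩ (connEvent ends s y)ᶜ) =
      prob p (connEvent ends s b) - prob p (connEvent ends y b) -
        prob p (connEvent ends s y ∩ connEvent ends s b ∩ (connEvent ends y b)ᶜ) := by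
  have hB := prob_inter_add_prob_inter_compl p (connEvent ends s b) (connEvent ends s y)
  have hC := prob_inter_add_prob_inter_compl p (connEvent ends y b) (connEvent ends s y)
  have hS := prob_inter_add_prob_inter_compl p (connEvent ends s y ∩ connEvent ends s b)
    (connEvent ends y b)
  have e1 : connEvent ends y b ∩ connEvent ends s y =
      connEvent ends s y ∩ connEvent ends s b ∩ connEvent ends y b := by
    ext ω
    simp only [Set.mem_inter_iff, mem_connEvent]
    exact ⟨fun ⟨h1, h2⟩ => ⟨⟨h2, conn_trans h2 h1⟩, h1⟩, fun ⟨⟨h1, _⟩, h2⟩ => ⟨h2, h1⟩⟩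
  have e2 : connEvent ends s b ∩ connEvent ends s y = connEvent ends s y ∩ connEvent ends s b :=
    Set.inter_comm _ _
  rw [e1] at hC
  rw [e2] at hB
  linarith

/-- **Quantitative R10 at one root, multiplied out**:
`P(o ∈ C, y ∉ C) · (P(b ∈ C) − P(y ↔ b) − P(y | b)) ≤ (P(o ∈ C, b ∈ C, y ∉ C) − P(o ∈ C, y ∉ C, y ↔ b)) · P(y ∉ C)`,
`C = C(s)`. -/
theorem orderPreserving_quant_mul (p : E → R) (hp : IsProbVec p) (ends : E → Sym2 V)
    (s o y b : V) :
    prob p (connEvent ends s o ∩ (connEvent ends s y)ᶜ) *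
        (prob p (connEvent ends s b) - prob p (connEvent ends y b) -
          prob p (connEvent ends s y ∩ connEvent ends s b ∩ (connEvent ends y b)ᶜ)) ≤
      (prob p (connEvent ends s o ∩ connEvent ends s b ∩ (connEvent ends s y)ᶜ) -
          prob p (connEvent ends s o ∩ (connEvent ends s y)ᶜ ∩ connEvent ends y b)) *
        prob p (connEvent ends s y)ᶜ := by
  classical
  have h𝓤 : IsUpperSet {W : Set V | o ∈ W} := isUpperSet_mem_setOf o
  have h𝓥 : IsUpperSet {W : Set V | b ∈ W} := isUpperSet_mem_setOf b
  set g := delClusterProb p ends y {W : Set V | b ∈ W} with hg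
  have hg_anti : Antitone g := delClusterProb_anti p hp ends y h𝓥
  have hg1 : ∀ W, g W ≤ 1 := delClusterProb_le_one p hp ends y _
  have hF₁ : Monotone ({W : Set V | o ∈ W}.indicator (1 : Set V → R)) :=
    monotone_indicator_one_of_isUpperSet h𝓤
  have hF₂ : Monotone (fun W => {W : Set V | b ∈ W}.indicator (1 : Set V → R) W + (1 - g W)) :=
    fun W W' h => by
      have h1 := monotone_indicator_one_of_isUpperSet (R := R) h𝓥 h
      have h2 := hg_anti h
      simp only
      linarith
  have hF₁0 : ∀ W, 0 ≤ {W : Set V | o ∈ W}.indicator (1 : Set V → R) W :=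
    fun W => Set.indicator_apply_nonneg fun _ => zero_le_one
  have hF₂0 : ∀ W, 0 ≤ {W : Set V | b ∈ W}.indicator (1 : Set V → R) W + (1 - g W) := fun W =>
    add_nonneg (Set.indicator_apply_nonneg fun _ => zero_le_one) (by linarith [hg1 W])
  have key := bhk_same_cluster p hp ends s y hF₁ hF₂ hF₁0 hF₂0
  beta_reduce at key
  -- the elementary expectations
  have eU : expect p (fun ω => {W : Set V | o ∈ W}.indicator 1 (cluster ends ω s) *
      ((connEvent ends s y)ᶜ).indicator 1 ω) =
      prob p (connEvent ends s o ∩ (connEvent ends s y)ᶜ) := by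
    rw [connEvent_eq_clusterInEvent ends s o, prob_clusterInEvent_inter_eq_expect]
  have eV : expect p (fun ω => {W : Set V | b ∈ W}.indicator 1 (cluster ends ω s) *
      ((connEvent ends s y)ᶜ).indicator 1 ω) =
      prob p (connEvent ends s b ∩ (connEvent ends s y)ᶜ) := by
    rw [connEvent_eq_clusterInEvent ends s b, prob_clusterInEvent_inter_eq_expect]
  have eD : expect p (fun ω => ((connEvent ends s y)ᶜ).indicator 1 ω) =
      prob p (connEvent ends s y)ᶜ := (prob_eq_expect_indicator p _).symm
  have eg : expect p (fun ω => g (cluster ends ω s) * ((connEvent ends s y)ᶜ).indicator 1 ω) =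
      prob p (connEvent ends y b ∩ (connEvent ends s y)ᶜ) := by
    have h := prob_clusterIn_inter_eq_expect p ends s y Set.univ {W : Set V | b ∈ W}
    simp only [Set.indicator_univ, Pi.one_apply, one_mul] at h
    rw [connEvent_eq_clusterInEvent ends y b, ← h]
    congr 1
    ext ω
    simp [clusterInEvent]
  have e' : clusterInEvent ends s ({W : Set V | o ∈ W} ∩ {W : Set V | b ∈ W}) =
      clusterInEvent ends s {W : Set V | o ∈ W} ∩ clusterInEvent ends s {W : Set V | b ∈ W} := by
    ext ω
    simp [clusterInEvent]
  have eUV : expect p (fun ω => {W : Set V | o ∈ W}.indicator 1 (cluster ends ω s) *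
      {W : Set V | b ∈ W}.indicator 1 (cluster ends ω s) * ((connEvent ends s y)ᶜ).indicator 1 ω) =
      prob p (connEvent ends s o ∩ connEvent ends s b ∩ (connEvent ends s y)ᶜ) := by
    have e : (fun ω => {W : Set V | o ∈ W}.indicator (1 : Set V → R) (cluster ends ω s) *
        {W : Set V | b ∈ W}.indicator 1 (cluster ends ω s) * ((connEvent ends s y)ᶜ).indicator 1 ω) =
        fun ω => ({W : Set V | o ∈ W} ∩ {W : Set V | b ∈ W}).indicator 1 (cluster ends ω s) *
          ((connEvent ends s y)ᶜ).indicator 1 ω := by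
      funext ω
      by_cases h1 : cluster ends ω s ∈ {W : Set V | o ∈ W} <;>
        by_cases h2 : cluster ends ω s ∈ {W : Set V | b ∈ W} <;> simp [h1, h2]
    rw [e, ← prob_clusterInEvent_inter_eq_expect, e', connEvent_eq_clusterInEvent ends s o,
      connEvent_eq_clusterInEvent ends s b]
  have eUg : expect p (fun ω => {W : Set V | o ∈ W}.indicator 1 (cluster ends ω s) *
      g (cluster ends ω s) * ((connEvent ends s y)ᶜ).indicator 1 ω) =
      prob p (connEvent ends s o ∩ connEvent ends y b ∩ (connEvent ends s y)ᶜ) := by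
    rw [connEvent_eq_clusterInEvent ends s o, connEvent_eq_clusterInEvent ends y b,
      prob_clusterIn_inter_eq_expect]
  -- the two composite expectations
  have e2 : expect p (fun ω => ({W : Set V | b ∈ W}.indicator 1 (cluster ends ω s) +
      (1 - g (cluster ends ω s))) * ((connEvent ends s y)ᶜ).indicator 1 ω) =
      prob p (connEvent ends s b ∩ (connEvent ends s y)ᶜ) + prob p (connEvent ends s y)ᶜ -
        prob p (connEvent ends y b ∩ (connEvent ends s y)ᶜ) := by
    rw [← eV, ← eD, ← eg, ← expect_add, ← expect_sub]
    congr 1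
    funext ω
    simp only [Pi.add_apply, Pi.sub_apply]
    ring
  have e3 : expect p (fun ω => {W : Set V | o ∈ W}.indicator 1 (cluster ends ω s) *
      ({W : Set V | b ∈ W}.indicator 1 (cluster ends ω s) + (1 - g (cluster ends ω s))) *
      ((connEvent ends s y)ᶜ).indicator 1 ω) =
      prob p (connEvent ends s o ∩ connEvent ends s b ∩ (connEvent ends s y)ᶜ) +
        prob p (connEvent ends s o ∩ (connEvent ends s y)ᶜ) -
        prob p (connEvent ends s o ∩ connEvent ends y b ∩ (connEvent ends s y)ᶜ) := by
    rw [← eUV, ← eU, ← eUg, ← expect_add, ← expect_sub]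
    congr 1
    funext ω
    simp only [Pi.add_apply, Pi.sub_apply]
    ring
  rw [eU, e2, e3] at key
  -- the cancellation and the final rearrangement
  have hcancel := prob_conn_sub_eq_split p ends s y b
  rw [← hcancel, Set.inter_right_comm (connEvent ends s o) (connEvent ends s y)ᶜ
    (connEvent ends y b)]
  nlinarith [key]

/-- **Quantitative R10 at one root** (conditional form; `x / 0 = 0`):
`P(o ∈ C, b ∈ C, y ∉ C) − P(o ∈ C, y ∉ C, y ↔ b) ≥ P(o ∈ C | y ∉ C) · (P(b ∈ C) − P(y ↔ b) − P(y | b))`. -/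
theorem orderPreserving_quant (p : E → R) (hp : IsProbVec p) (ends : E → Sym2 V) (s o y b : V) :
    prob p (connEvent ends s o ∩ connEvent ends s b ∩ (connEvent ends s y)ᶜ) -
        prob p (connEvent ends s o ∩ (connEvent ends s y)ᶜ ∩ connEvent ends y b) ≥
      prob p (connEvent ends s o ∩ (connEvent ends s y)ᶜ) / prob p (connEvent ends s y)ᶜ *
        (prob p (connEvent ends s b) - prob p (connEvent ends y b) -
          prob p (connEvent ends s y ∩ connEvent ends s b ∩ (connEvent ends y b)ᶜ)) := by
  have key := orderPreserving_quant_mul p hp ends s o y b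
  have hD : 0 ≤ prob p (connEvent ends s y)ᶜ := prob_nonneg hp _
  rcases hD.lt_or_eq with hDpos | hD0
  · rw [ge_iff_le, div_mul_eq_mul_div, div_le_iff₀ hDpos]
    exact key
  · -- `P(y ∉ C) = 0`: both sides vanish
    rw [← hD0, div_zero, zero_mul]
    have h1 : prob p (connEvent ends s o ∩ connEvent ends s b ∩ (connEvent ends s y)ᶜ) = 0 :=
      le_antisymm (hD0 ▸ prob_mono hp Set.inter_subset_right) (prob_nonneg hp _)
    have h2 : prob p (connEvent ends s o ∩ (connEvent ends s y)ᶜ ∩ connEvent ends y b) = 0 :=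
      le_antisymm (hD0 ▸ prob_mono hp (Set.inter_subset_left.trans Set.inter_subset_right))
        (prob_nonneg hp _)
    rw [h1, h2, sub_zero]

end Quant

end Summit.Ventures.PercRepro2
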